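import Mathlib

/-!
# Pointwise weights of the rule-2 moves of line `picard-involution-quotient` (crux stmt-KontsevichZagierPeriods-13215)

Refuter drefute — positive helper lemmas, attached as EVIDENCE for the lead (not proposals).

* `constantsAgree` : `4√3(√3+1)·(3+2√3)^(-1/4) = 4√2·c₀`, `c₀ = 2^(-1/4)·3^(3/8)·√(1+√3)` (stub T's constant);
* `cubeWeight`     : `(t³)^(-11/12)·(1-t³)^(-3/4)·(3t²) = 3(t-t⁴)^(-3/4)` on `(0,1)` (stub E's rule-2 identity);
* `twistWeight`    : `f₃(√D/s²)·(2√D/s³) = f₄(s)` on `(0,1)` (stub T's rule-2 identity, `Φ(s) = √D/s²`).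
-/

namespace DrefuteMoveWeights

theorem sqrt3_mul_self : Real.sqrt 3 * Real.sqrt 3 = 3 := Real.mul_self_sqrt (by norm_num)

/-- `c₀⁸ = 189 + 108√3` for the LITERAL constant of the stubs. -/
theorem c0_pow_eight :
    ((2:ℝ) ^ (-(1:ℝ)/4) * (3:ℝ) ^ ((3:ℝ)/8) * Real.sqrt (1 + Real.sqrt 3)) ^ 8 = 189 + 108 * Real.sqrt 3 := by
  have h3 := sqrt3_mul_self
  rw [mul_pow, mul_pow]
  have e1 : ((2:ℝ) ^ (-(1:ℝ)/4)) ^ 8 = 1 / 4 := by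
    rw [← Real.rpow_mul_natCast (by norm_num), show (-(1:ℝ)/4) * ((8:ℕ):ℝ) = -((2:ℕ):ℝ) by norm_num,
      Real.rpow_neg (by norm_num), Real.rpow_natCast]; norm_num
  have e2 : ((3:ℝ) ^ ((3:ℝ)/8)) ^ 8 = 27 := by
    rw [← Real.rpow_mul_natCast (by norm_num), show ((3:ℝ)/8) * ((8:ℕ):ℝ) = ((3:ℕ):ℝ) by norm_num,
      Real.rpow_natCast]; norm_num
  have e3 : (Real.sqrt (1 + Real.sqrt 3)) ^ 8 = (1 + Real.sqrt 3) ^ 4 := by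
    rw [show (8:ℕ) = 2 * 4 by norm_num, pow_mul, Real.sq_sqrt (by positivity)]
  rw [e1, e2, e3]
  have h2 : Real.sqrt 3 ^ 2 = 3 := by rw [pow_two]; exact h3
  have h4 : Real.sqrt 3 ^ 4 = 9 := by nlinarith [h2]
  have h3' : Real.sqrt 3 ^ 3 = 3 * Real.sqrt 3 := by rw [pow_succ, h2]
  ring_nf
  rw [h2, h3', h4]
  ring

/-- **ConstantsAgree**: `4√3(√3+1)(3+2√3)^(-1/4) = 4√2·c₀`. -/
theorem constantsAgree :
    4 * Real.sqrt 3 * (Real.sqrt 3 + 1) * (3 + 2 * Real.sqrt 3) ^ (-(1:ℝ)/4)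
      = 4 * Real.sqrt 2 * ((2:ℝ) ^ (-(1:ℝ)/4) * (3:ℝ) ^ ((3:ℝ)/8) * Real.sqrt (1 + Real.sqrt 3)) := by
  have h3 := sqrt3_mul_self
  have hs0 : 0 < Real.sqrt 3 := Real.sqrt_pos.mpr (by norm_num)
  have hD0 : 0 < 3 + 2 * Real.sqrt 3 := by positivity
  have hL : 0 < 4 * Real.sqrt 3 * (Real.sqrt 3 + 1) * (3 + 2 * Real.sqrt 3) ^ (-(1:ℝ)/4) := by positivity
  have hR : 0 < 4 * Real.sqrt 2 * ((2:ℝ) ^ (-(1:ℝ)/4) * (3:ℝ) ^ ((3:ℝ)/8) * Real.sqrt (1 + Real.sqrt 3)) := by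
    positivity
  rw [← pow_left_inj₀ hL.le hR.le (by norm_num : (8:ℕ) ≠ 0)]
  rw [mul_pow, mul_pow, mul_pow, mul_pow, mul_pow, c0_pow_eight]
  have eD : ((3 + 2 * Real.sqrt 3) ^ (-(1:ℝ)/4)) ^ 8 = ((3 + 2 * Real.sqrt 3) ^ 2)⁻¹ := by
    rw [← Real.rpow_mul_natCast hD0.le, show (-(1:ℝ)/4) * ((8:ℕ):ℝ) = -((2:ℕ):ℝ) by norm_num,
      Real.rpow_neg hD0.le, Real.rpow_natCast]
  have e2 : Real.sqrt 2 ^ 8 = 16 := by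
    rw [show (8:ℕ) = 2 * 4 by norm_num, pow_mul, Real.sq_sqrt (by norm_num)]; norm_num
  have es : Real.sqrt 3 ^ 8 = 81 := by
    rw [show (8:ℕ) = 2 * 4 by norm_num, pow_mul, Real.sq_sqrt (by norm_num)]; norm_num
  rw [eD, e2, es]
  have hD2 : (3 + 2 * Real.sqrt 3) ^ 2 ≠ 0 := pow_ne_zero _ hD0.ne'
  field_simp
  -- 4⁸·81·(√3+1)⁸ = 4⁸·16·(189+108√3)·(3+2√3)²
  have h2 : Real.sqrt 3 ^ 2 = 3 := by rw [pow_two]; exact h3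
  have h4 : Real.sqrt 3 ^ 4 = 9 := by nlinarith [h2]
  have h3' : Real.sqrt 3 ^ 3 = 3 * Real.sqrt 3 := by rw [pow_succ, h2]
  have h5 : Real.sqrt 3 ^ 5 = 9 * Real.sqrt 3 := by rw [pow_succ, h4]
  have h6 : Real.sqrt 3 ^ 6 = 27 := by nlinarith [h2, h4]
  have h7 : Real.sqrt 3 ^ 7 = 27 * Real.sqrt 3 := by rw [pow_succ, h6]
  have h8 : Real.sqrt 3 ^ 8 = 81 := by nlinarith [h4]
  ring_nf
  rw [h2, h3', h4, h5, h6, h7, h8]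
  ring

/-- Stub E's rule-2 identity (`x = t³`). -/
theorem cubeWeight (t : ℝ) (ht : t ∈ Set.Ioo (0:ℝ) 1) :
    (t ^ 3) ^ (-(11:ℝ)/12) * (1 - t ^ 3) ^ (-(3:ℝ)/4) * (3 * t ^ 2) = 3 * (t - t ^ 4) ^ (-(3:ℝ)/4) := by
  obtain ⟨ht0, ht1⟩ := ht
  have h1 : 0 < 1 - t ^ 3 := by nlinarith [pow_lt_one₀ ht0.le ht1 (by norm_num : (3:ℕ) ≠ 0)]
  have e1 : (t ^ 3) ^ (-(11:ℝ)/12) = t ^ (-(11:ℝ)/4) := by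
    rw [show t ^ 3 = t ^ ((3:ℕ):ℝ) from (Real.rpow_natCast t 3).symm, ← Real.rpow_mul ht0.le]; norm_num
  have e2 : t - t ^ 4 = t * (1 - t ^ 3) := by ring
  have e3 : (t * (1 - t ^ 3)) ^ (-(3:ℝ)/4) = t ^ (-(3:ℝ)/4) * (1 - t ^ 3) ^ (-(3:ℝ)/4) :=
    Real.mul_rpow ht0.le h1.le
  have e4 : t ^ 2 = t ^ ((2:ℕ):ℝ) := (Real.rpow_natCast t 2).symm
  rw [e1, e2, e3, e4]
  have e5 : t ^ (-(11:ℝ)/4) * t ^ (((2:ℕ):ℝ)) = t ^ (-(3:ℝ)/4) := by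
    rw [← Real.rpow_add ht0]; norm_num
  calc t ^ (-(11:ℝ)/4) * (1 - t ^ 3) ^ (-(3:ℝ)/4) * (3 * t ^ ((2:ℕ):ℝ))
      = 3 * (t ^ (-(11:ℝ)/4) * t ^ ((2:ℕ):ℝ)) * (1 - t ^ 3) ^ (-(3:ℝ)/4) := by ring
    _ = 3 * (t ^ (-(3:ℝ)/4) * (1 - t ^ 3) ^ (-(3:ℝ)/4)) := by rw [e5]; ring

/-- Stub T's rule-2 identity (`Φ(s) = √D/s²`, `|Φ'(s)| = 2√D/s³`, `D = 3 + 2√3`). -/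
theorem twistWeight (s : ℝ) (hs : s ∈ Set.Ioo (0:ℝ) 1) :
    2 * Real.sqrt 3 * (Real.sqrt 3 + 1) *
        ((Real.sqrt (3 + 2 * Real.sqrt 3) / s ^ 2) ^ 3
          - (3 + 2 * Real.sqrt 3) * (Real.sqrt (3 + 2 * Real.sqrt 3) / s ^ 2)) ^ (-(1:ℝ)/2)
        * (2 * Real.sqrt (3 + 2 * Real.sqrt 3) / s ^ 3)
      = 4 * Real.sqrt 2 * ((2:ℝ) ^ (-(1:ℝ)/4) * (3:ℝ) ^ ((3:ℝ)/8) * Real.sqrt (1 + Real.sqrt 3))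
        * (1 - s ^ 4) ^ (-(1:ℝ)/2) := by
  obtain ⟨hs0, hs1⟩ := hs
  rw [← constantsAgree]
  have hD0 : 0 < 3 + 2 * Real.sqrt 3 := by positivity
  set D := 3 + 2 * Real.sqrt 3 with hD
  set r := Real.sqrt D with hr
  have hr0 : 0 < r := Real.sqrt_pos.mpr hD0
  have hr2 : r ^ 2 = D := Real.sq_sqrt hD0.le
  have h14 : 0 < 1 - s ^ 4 := by nlinarith [pow_lt_one₀ hs0.le hs1 (by norm_num : (4:ℕ) ≠ 0)]
  -- the base: (r/s²)³ - D (r/s²) = r³ (1 - s⁴) / s⁶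
  have hbase : (r / s ^ 2) ^ 3 - D * (r / s ^ 2) = r ^ 3 * (1 - s ^ 4) / s ^ 6 := by
    rw [← hr2]; field_simp
  rw [hbase]
  have hr_rpow : r = D ^ ((1:ℝ)/2) := by rw [hr, Real.sqrt_eq_rpow]
  have e1 : (r ^ 3 * (1 - s ^ 4) / s ^ 6) ^ (-(1:ℝ)/2)
      = (r ^ 3) ^ (-(1:ℝ)/2) * (1 - s ^ 4) ^ (-(1:ℝ)/2) / (s ^ 6) ^ (-(1:ℝ)/2) := by
    rw [Real.div_rpow (by positivity) (by positivity), Real.mul_rpow (by positivity) h14.le]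
  have e2 : (r ^ 3) ^ (-(1:ℝ)/2) = D ^ (-(3:ℝ)/4) := by
    rw [hr_rpow, ← Real.rpow_natCast, ← Real.rpow_mul hD0.le, ← Real.rpow_mul hD0.le]; norm_num
  have e3 : (s ^ 6) ^ (-(1:ℝ)/2) = (s ^ 3)⁻¹ := by
    rw [show ((s ^ 6 : ℝ)) = s ^ ((6:ℕ):ℝ) from (Real.rpow_natCast s 6).symm, ← Real.rpow_mul hs0.le,
      show ((6:ℕ):ℝ) * (-(1:ℝ)/2) = -((3:ℕ):ℝ) by norm_num, Real.rpow_neg hs0.le, Real.rpow_natCast]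
  have e4 : r = D ^ ((3:ℝ)/4) * D ^ (-(1:ℝ)/4) := by
    rw [← Real.rpow_add hD0, hr_rpow]; norm_num
  rw [e1, e2, e3, e4, div_inv_eq_mul]
  have hs3 : s ^ 3 ≠ 0 := by positivity
  have key : D ^ (-(3:ℝ)/4) * D ^ ((3:ℝ)/4) = 1 := by
    rw [← Real.rpow_add hD0]; norm_num
  calc 2 * Real.sqrt 3 * (Real.sqrt 3 + 1) * (D ^ (-(3:ℝ)/4) * (1 - s ^ 4) ^ (-(1:ℝ)/2) * s ^ 3)
        * (2 * (D ^ ((3:ℝ)/4) * D ^ (-(1:ℝ)/4)) / s ^ 3)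
      = 4 * Real.sqrt 3 * (Real.sqrt 3 + 1) * D ^ (-(1:ℝ)/4) * (1 - s ^ 4) ^ (-(1:ℝ)/2)
          * (D ^ (-(3:ℝ)/4) * D ^ ((3:ℝ)/4)) * (s ^ 3 / s ^ 3) := by ring
    _ = 4 * Real.sqrt 3 * (Real.sqrt 3 + 1) * D ^ (-(1:ℝ)/4) * (1 - s ^ 4) ^ (-(1:ℝ)/2) := by
          rw [key, div_self hs3]; ring

end DrefuteMoveWeights

namespace DrefuteMoveWeights

/-- Stub F's rule-2 identity (the fold by the involution `m(t) = (1-t)/(1+2t)`, `|m'(t)| = 3/(1+2t)²`):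
`g_E(m t)·|m'(t)| = -g_E(t)` with `g_E(u) = (u + (1-√3)/2)(u - u⁴)^(-3/4)`. -/
theorem foldWeight (t : ℝ) (ht : t ∈ Set.Ioo (0:ℝ) 1) :
    ((1 - t) / (1 + 2 * t) + (1 - Real.sqrt 3) / 2)
        * ((1 - t) / (1 + 2 * t) - ((1 - t) / (1 + 2 * t)) ^ 4) ^ (-(3:ℝ)/4) * (3 / (1 + 2 * t) ^ 2)
      = -((t + (1 - Real.sqrt 3) / 2) * (t - t ^ 4) ^ (-(3:ℝ)/4)) := by
  obtain ⟨ht0, ht1⟩ := ht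
  have h3 := sqrt3_mul_self
  have hb : 0 < 1 + 2 * t := by linarith
  have htt : 0 < t - t ^ 4 := by
    have : t - t ^ 4 = t * (1 - t) * (1 + t + t ^ 2) := by ring
    rw [this]; exact mul_pos (mul_pos ht0 (by linarith)) (by positivity)
  -- Möbius lift: m - m⁴ = 9 (t - t⁴) / (1+2t)⁴
  have hlift : (1 - t) / (1 + 2 * t) - ((1 - t) / (1 + 2 * t)) ^ 4
      = 9 * (t - t ^ 4) / (1 + 2 * t) ^ 4 := by
    field_simp
    ring
  -- fold shift: m + (1-√3)/2 = -√3 (t + (1-√3)/2) / (1+2t)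
  have hshift : (1 - t) / (1 + 2 * t) + (1 - Real.sqrt 3) / 2
      = -(Real.sqrt 3 * (t + (1 - Real.sqrt 3) / 2)) / (1 + 2 * t) := by
    field_simp
    linear_combination (-(1:ℝ)) * h3
  have e1 : (9 * (t - t ^ 4) / (1 + 2 * t) ^ 4) ^ (-(3:ℝ)/4)
      = (9:ℝ) ^ (-(3:ℝ)/4) * (t - t ^ 4) ^ (-(3:ℝ)/4) / ((1 + 2 * t) ^ 4) ^ (-(3:ℝ)/4) := by
    rw [Real.div_rpow (by positivity) (by positivity), Real.mul_rpow (by norm_num) htt.le]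
  have e2 : ((1 + 2 * t) ^ 4) ^ (-(3:ℝ)/4) = ((1 + 2 * t) ^ 3)⁻¹ := by
    rw [show ((1 + 2 * t) ^ 4 : ℝ) = (1 + 2 * t) ^ ((4:ℕ):ℝ) from (Real.rpow_natCast _ 4).symm,
      ← Real.rpow_mul hb.le, show ((4:ℕ):ℝ) * (-(3:ℝ)/4) = -((3:ℕ):ℝ) by norm_num,
      Real.rpow_neg hb.le, Real.rpow_natCast]
  -- √3 · 3 · 9^(-3/4) = 1
  have e3 : Real.sqrt 3 * 3 * (9:ℝ) ^ (-(3:ℝ)/4) = 1 := by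
    have hl : 0 < Real.sqrt 3 * 3 * (9:ℝ) ^ (-(3:ℝ)/4) := by positivity
    rw [← pow_left_inj₀ hl.le zero_le_one (by norm_num : (4:ℕ) ≠ 0), mul_pow, mul_pow, one_pow,
      ← Real.rpow_mul_natCast (by norm_num : (0:ℝ) ≤ 9),
      show (-(3:ℝ)/4) * ((4:ℕ):ℝ) = -((3:ℕ):ℝ) by norm_num, Real.rpow_neg (by norm_num), Real.rpow_natCast,
      show (4:ℕ) = 2 * 2 from rfl, pow_mul, Real.sq_sqrt (by norm_num)]
    norm_num
  rw [hlift, hshift, e1, e2, div_inv_eq_mul]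
  have key : (1 + 2 * t)⁻¹ * (1 + 2 * t) ^ 3 * ((1 + 2 * t) ^ 2)⁻¹ = 1 := by
    field_simp
  calc -(Real.sqrt 3 * (t + (1 - Real.sqrt 3) / 2)) / (1 + 2 * t)
          * ((9:ℝ) ^ (-(3:ℝ)/4) * (t - t ^ 4) ^ (-(3:ℝ)/4) * (1 + 2 * t) ^ 3) * (3 / (1 + 2 * t) ^ 2)
      = -(Real.sqrt 3 * 3 * (9:ℝ) ^ (-(3:ℝ)/4)) * ((t + (1 - Real.sqrt 3) / 2) * (t - t ^ 4) ^ (-(3:ℝ)/4))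
          * ((1 + 2 * t)⁻¹ * (1 + 2 * t) ^ 3 * ((1 + 2 * t) ^ 2)⁻¹) := by ring
    _ = -((t + (1 - Real.sqrt 3) / 2) * (t - t ^ 4) ^ (-(3:ℝ)/4)) := by rw [e3, key]; ring

/-- Stub B's rule-2 identity (lemniscatic normalisation): with `x(s) = (1 - √(1-s⁴))/2 ∈ (0, 1/2)`,
`x'(s) = s³/√(1-s⁴)` and `x(1-x) = s⁴/4`, the doubled kernel transforms as
`2·c·x^(-3/4)(1-x)^(-3/4)·x'(s) = 4√2·c·(1-s⁴)^(-1/2)` (any constant `c`). -/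
theorem lemniWeight (c : ℝ) (s : ℝ) (hs : s ∈ Set.Ioo (0:ℝ) 1) :
    2 * (c * ((1 - Real.sqrt (1 - s ^ 4)) / 2) ^ (-(3:ℝ)/4) * (1 - (1 - Real.sqrt (1 - s ^ 4)) / 2) ^ (-(3:ℝ)/4))
        * (s ^ 3 / Real.sqrt (1 - s ^ 4))
      = 4 * Real.sqrt 2 * c * (1 - s ^ 4) ^ (-(1:ℝ)/2) := by
  obtain ⟨hs0, hs1⟩ := hs
  have h14 : 0 < 1 - s ^ 4 := by nlinarith [pow_lt_one₀ hs0.le hs1 (by norm_num : (4:ℕ) ≠ 0)]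
  have h14' : 1 - s ^ 4 < 1 := by
    have : 0 < s ^ 4 := by positivity
    linarith
  set q := Real.sqrt (1 - s ^ 4) with hq
  have hq0 : 0 < q := Real.sqrt_pos.mpr h14
  have hq1 : q < 1 := by
    have h := Real.sqrt_lt_sqrt h14.le h14'
    rwa [Real.sqrt_one] at h
  have hq2 : q ^ 2 = 1 - s ^ 4 := Real.sq_sqrt h14.le
  have hx0 : 0 < (1 - q) / 2 := by linarith
  have hx1 : 0 < 1 - (1 - q) / 2 := by linarith
  -- x(1-x) = s⁴/4
  have hprod : ((1 - q) / 2) * (1 - (1 - q) / 2) = s ^ 4 / 4 := by nlinarith [hq2]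
  have e1 : ((1 - q) / 2) ^ (-(3:ℝ)/4) * (1 - (1 - q) / 2) ^ (-(3:ℝ)/4) = (s ^ 4 / 4) ^ (-(3:ℝ)/4) := by
    rw [← Real.mul_rpow hx0.le hx1.le, hprod]
  have e2 : (s ^ 4 / 4) ^ (-(3:ℝ)/4) = (s ^ 3)⁻¹ * (4:ℝ) ^ ((3:ℝ)/4) := by
    rw [Real.div_rpow (by positivity) (by norm_num),
      show ((s ^ 4 : ℝ)) = s ^ ((4:ℕ):ℝ) from (Real.rpow_natCast s 4).symm, ← Real.rpow_mul hs0.le,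
      show ((4:ℕ):ℝ) * (-(3:ℝ)/4) = -((3:ℕ):ℝ) by norm_num, Real.rpow_neg hs0.le, Real.rpow_natCast,
      neg_div, Real.rpow_neg (by norm_num : (0:ℝ) ≤ 4), div_inv_eq_mul]
  have e3 : q = ((1 - s ^ 4) ^ (-(1:ℝ)/2))⁻¹ := by
    rw [neg_div, Real.rpow_neg h14.le, inv_inv, hq, Real.sqrt_eq_rpow]
  -- 2 · 4^(3/4) = 4 √2  (fourth powers: 16 · 64 = 256 · 4)
  have hsq : Real.sqrt 2 ^ 4 = 4 := by
    rw [show (4:ℕ) = 2 * 2 by norm_num, pow_mul, Real.sq_sqrt (by norm_num)]; norm_num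
  have e4 : 2 * (4:ℝ) ^ ((3:ℝ)/4) = 4 * Real.sqrt 2 := by
    have hl : 0 < 2 * (4:ℝ) ^ ((3:ℝ)/4) := by positivity
    have hr : 0 < 4 * Real.sqrt 2 := by positivity
    rw [← pow_left_inj₀ hl.le hr.le (by norm_num : (4:ℕ) ≠ 0), mul_pow, mul_pow, hsq,
      ← Real.rpow_mul_natCast (by norm_num : (0:ℝ) ≤ 4),
      show ((3:ℝ)/4) * ((4:ℕ):ℝ) = ((3:ℕ):ℝ) by norm_num, Real.rpow_natCast]
    norm_num
  rw [mul_assoc c, e1, e2, e3, div_inv_eq_mul]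
  have hs3 : s ^ 3 ≠ 0 := by positivity
  calc 2 * (c * ((s ^ 3)⁻¹ * (4:ℝ) ^ ((3:ℝ)/4))) * (s ^ 3 * (1 - s ^ 4) ^ (-(1:ℝ)/2))
      = (2 * (4:ℝ) ^ ((3:ℝ)/4)) * c * (1 - s ^ 4) ^ (-(1:ℝ)/2) * ((s ^ 3)⁻¹ * s ^ 3) := by ring
    _ = 4 * Real.sqrt 2 * c * (1 - s ^ 4) ^ (-(1:ℝ)/2) := by rw [e4, inv_mul_cancel₀ hs3]; ring

end DrefuteMoveWeights
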